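import Summits.QuantumFields.YangMills.Theorems.BalabanUVNodesN12ClassLetterGeometryOfRecord
import Literature.MathematicalPhysics.QuantumFieldTheory.Balaban1983to89.Node00.MultiScaleFibreChartB
import Summits.QuantumFields.YangMills.Theorems.BalabanUVNodesN12ClassLettersAtClosedClassOfRecordB
import HarnessLib

/-!
# BalabanUVNodes ∕ N12 — THE CLASS LETTERS OF THE w1 LINEAGE's CHART THEOREM, PART 3: THE GEOMETRY LETTER INHABITED AT THE RECORD — **BOND-DATUM EDITION** (`…N12ClassLetterGeometryOfRecordB`, USED DECLARATIONS ONLY)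

The print-datum ([Balaban1984PropagatorsII] (2.3)) (γ) twin of `Summits/…/Theorems/BalabanUVNodesN12ClassLetterGeometryOfRecord.lean`: the declarations of the parent whose STATEMENT reads the determining datum
(`classLetters_closure_regMSCoPOfRecord_Bj`) and which N12's junction of record v14ᴸ uses (dag-n12-c g35 probe-2 census `UsedConstsN12RoadTyped2`, THEOREMS block), re-typed over a
BOND-LEVEL datum `𝔅 : BDetSet` (F0a `B15DeterminingSetsB`) and dag-n12-c's bond-datum chart `Node00.msChartB` (✓p774329; `msChart 𝐁 = msChartB (bondsDet 𝐁)` by `rfl`).  GENERATOR twin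
(this seat's `work/g32/gen_thm.py`, block-extracted from the parent's tree bytes): namespace `…N12ClassLetterGeometryOfRecordB`, SAME short names, `DetSet ↦ BDetSet`, `AgreeOn 𝐁 ↦ AgreeOnB 𝔅`,
`IsMinimizer ↦ IsMinimizerB`, `bondsOf (𝐁 j) ↦ 𝔅 j`, `msChart ∕ constrCard ∕ constrEnum ∕ ConstrSet ↦ …B`, NODE 00 chart lemmas `…msChart… ↦ …msChartB…`; proofs VERBATIM; the parent's
datum-free declarations REUSED BY NAME (`open`), never copied (private plumbing excepted, №366 R2).  The parent's (b) statements are the instances `𝔅 := bondsDet 𝐁`.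

Cell `pub-ymgap` (HUMAN RULINGS D-0062 ∕ D-0149), seat `pub-ymgap-dag-n12-d` g32 (R134 N12 [B15] s2; the (ii) Theorems-side re-key of N12's road at print's [II] (2.3) datum — director-ym №338 ∕
№343 (E1)(iii-b), FLAG №16 ∕ ruling (α); dag-n12-c DESIGN memo a793b2ebc0b803bf (ii); `N12-ROAD-TWIN-ORDER-2026-08-30.md`).  Count-neutral helper of K1⁹ `stmt-QuantumFields-27364`,
`--kind proof --supports … --as helper`.  THEOREMS ONLY (0 `def`, 0 `instance`, 0 `sorry`).

HONEST FRAMING (director-ym №338 (5)).  PURELY ADDITIVE: the parent stays landed and true on its own text; nothing in it is edited; no displayed premise of any consumer is deleted or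
weakened; every hypothesis of the parent stays a hypothesis.  Nothing of Bałaban's analysis asserted; N12 NOT discharged; K0⁷ ∕ K1⁹ NOT closed; counts unmoved (typed 28∕28 · discharged
8∕27, A 8∕28; K 1∕4); one finite 𝕋⁴ programme at fixed ε — R4 closes the conditional rung `BalabanLadder.UV` only; NOT the Yang–Mills mass gap (Clay); nothing continuum ∕ ℝ⁴ ∕ OS.

PARENT's DOCSTRING (the mathematics and the citations; read the site-level `𝐁` as the bond datum `𝔅`):
# BalabanUVNodes ∕ N12 — THE CLASS LETTERS OF THE w1 LINEAGE's CHART THEOREM, PART 3: THE GEOMETRY LETTER INHABITED AT THE RECORD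
# (`𝐁 := 𝐁_k(Z)` of [Balaban1988Convergent] (2.13), `{Ω_n} := maxDomT M₁ Z`, support `Ω₀ := suppDomOfRecord`; [Balaban1985Variational] (1) p. 277 «(L^jη)^{-1}dist(Ω_j^c, Ω_{j+1}) > RM₁»,
# (7) p. 278 «by Proposition 2 [4] the configuration V satisfies (7) with ε₁ = O(ε₀)»; [Balaban1985Averaging] Prop. 2 p. 26)

Cell `pub-ymgap` (HUMAN RULINGS D-0062 ∕ D-0149), WIDTH SEAT `pub-ymgap-dag-n12-w1` g4 (node N12 = [B15]; key K1⁹ `stmt-QuantumFields-27364`, `--kind proof --supports … --as helper`;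
count-neutral).  THEOREMS ONLY (0 `def`, 0 `instance`, 0 `sorry`); consumed BY NAME: Part 2 (`…N12ClassLettersAtClosedClassOfRecord`, cone-box packaging), dag-n21-e's torus cover ∕
collar kit (`…N21ReadSetSupport`: `feeds_witness`, `src_mem_collar_of_feeds`, `cover_mem_collar_of_within`, `within_lift_of_blockIter_eq`, `blockIter_embIter`, `collar_mono`), dag-n21-c's
chains of block centres (`…N21LocalAveragedRegularityLevels.exists_embChain`), r11's (2.11) inputs `B14Eq216Concrete.feeds` ∕ (2.13) `B14Eq213DetSet.Bj` ∕ `maxDomT` ∕ `dist_maxDomT`, def-R's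
support of record `Node00.suppDomOfRecord` = `hullD M₁ 1 Ω₁`, and `B15Claim189LambdaPin.mem_hullD_of_near`.

WHY.  Parts 1–2 discharge the three CLASS letters (`IsClosed reg'`, `closure reg ⊆ reg'`, `hDreg'`) of the lineage's chart theorems
(`B15Prop1MinimiserFamilyFromThm1AtBaseCentral.hMin_atRecord_of_node00Letters_thm1AtBase_central`, `…N12RightInverseLetterOfForest.…_central_surj`) at `reg' := closure (regMSCoPOfRecord …)`
modulo ONE combinatorial geometry letter: per constrained bond `(j, c)` a bond family through `c` closed downward under the (0.4) window and, per member `c′` of level `i + 1`, a chain of block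
centres below `emb c′₋` whose bottom fine box `boxRegion (xs 0) (Lⁱ(2L + (d+4)L + 2))` lies in the plaquette sets the class controls at the levels `j′ ≥ j − 1`.  THIS FILE inhabits that
letter at the record's objects: the bond family is the FEEDS CONE `{b | feeds i b ⊆ feeds j c}` of (2.11) (closed under the window by `mem_feeds_succ`; never empty); a cone bond of level
`i + 1` has the centre of its block within `4L^j + 3L^{i+1} − 6` of the anchor `embIter j c₋` (or `c₊`) ∈ `Ω_j` on the cover (two calls of n21-e's `feeds_witness` through a common fine
input); the bottom box then sits within `(d+14)L^j`; by [III] (2.13)'s separation (`dist_maxDomT`: within `M₁L^j − 1` of `Ω_j` lies over `Ω_{j−1}`) it lies over `Ω_{j−1}` when `2 ≤ j`, and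
in the support `hullD M₁ 1 Ω₁` when `j = 1` — both under the single floor `(d+14)·L ≤ M₁` (print: «big blocks of the size M₁L^jη», `M₁` fixed large).  With Part 2 the three class letters
become theorems at `𝐁 := Bj ν.M₁ Z k`, `reg' := closure (Node00.regMSCoPOfRecord F N ν K kc (maxDomT ν.M₁ Z))` modulo NUMERICS ONLY.

CONTENTS.  §1 feeds cone (`feeds_subset_feeds_succ_of_window`, ★ `feedsCone_closedBelow`, `mem_feedsCone_self`, `feeds_nonempty`) · §2 collar bookkeeping (`cover_mem_collar_self`,
`mem_collar_of_blockIter_eq`, `cover_lift_add_apply`) · §3 ★ `embIter_src_mem_collar_of_cone` · §4 `embIter_chain_eq_bottom`, ★ `src_mem_collar_of_mem_boxRegion_chain` · §5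
`exists_within_of_mem_collar_one`, ★ `mem_maxDomT_pred_of_mem_collar`, `coordDist_cover_le_of_within`, ★ `mem_hullD_of_mem_collar` · §6 `Bj_subset_pts_maxDomT`, `coneBox_radius_le`,
`coneBox_radius_le_side`, ★★★ `coneBox_subset_levels` · §7 ★★★ `coneBoxLetter_Bj` (Part 2's letter inhabited), ★★★ `classLetters_closure_regMSCoPOfRecord_Bj` (THE TRIPLE at the record,
modulo numerics: `0 < εreg`, `C₀(d)·2L²εreg ≤ ⅓`, `2·2L²εreg ≤ c′₂`, `(d+14)·L ≤ M₁`, `M₁L^k ∣ N₀`, `k ≤ kc + 1`), ★★★ `continuousOn_constrainedAverages_closure_regMSCoPOfRecord_Bj` (`hDreg'` alone).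

HONEST FRAMING.  Lattice geometry on the torus of record + bookkeeping over Parts 1–2; the numerics are DISPLAYED (the record's «displayed defaults» `M₁ := 1`, `εreg := 1` of
`Node00.numerics7OfRecord₁₂` do NOT meet them — they are print's «M₁ large», «ε₀ small» windows, cf. n07-e's `floorGuard`); nothing of Bałaban's estimates asserted beyond the tree's
kernel theorems ([B7] Prop. 2 local = dag-n21-c ∕ dag-n11-d); N12 NOT discharged; K1⁹ NOT closed; counts unmoved; one finite 𝕋⁴ programme at fixed ε — R4 closes the conditional rung
`BalabanLadder.UV` only; the Yang–Mills mass gap (Clay) is NOT proved by any of this; nothing continuum ∕ ℝ⁴ ∕ OS.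
-/

noncomputable section

namespace Summit.QuantumFields.YangMills.BalabanUVNodes.N12ClassLetterGeometryOfRecordB

open Literature.MathematicalPhysics.QuantumFieldTheory.Balaban1983to89.B15DeterminingSetsB

open Set
open Literature.MathematicalPhysics.QuantumFieldTheory.Balaban1983to89
open B15DeterminingSets B14.Eq213DetSet B14.Eq216Concrete B14.Eq213MaximalDomains B15Eq112TorusCover B14DomainGeom
open B14.Eq22Determines (blockIter blockIter_zero blockIter_succ)
open Literature.MathematicalPhysics.QuantumFieldTheory.Balaban1983to89.Node00 (hullD topSeq topSeq_zero topSeq_of_ne_zero suppDomOfRecord regMSCoPOfRecord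
  avOfRecord SU Stage7Numerics constrCardB constrEnumB)
open Literature.MathematicalPhysics.QuantumFieldTheory.Balaban1983to89.T4Continuum (T4Family)
open Literature.MathematicalPhysics.QuantumFieldTheory.Balaban1983to89.ExpMeanLog (deltaSU)
open Summit.QuantumFields.YangMills.BalabanUVNodes.N12ClassLettersAtClosedClassOfRecordB (classLetters_closure_regMSCoPOfRecord_of_coneBoxes continuousOn_constrainedAverages_closure_regMSCoPOfRecord_of_coneBoxes)
open B8Eq17ClassAkV1 (plaqsOf)
open Summit.QuantumFields.YangMills.Theorems.N21ReadSetSupport (cover_mem_collar_of_within within_lift_of_blockIter_eq feeds_witness blockIter_embIter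
  collar_mono src_mem_collar_of_feeds)
open Summit.QuantumFields.YangMills.BalabanUVNodes.N20LCSAvgDominationRegion (boxRegion mem_boxRegion)
open Summit.QuantumFields.YangMills.Theorems.N21LocalAveragedRegularity (exists_embChain)
open Summit.QuantumFields.YangMills.BalabanUVNodes.N12ClassLetterGeometryOfRecord (coneBoxLetter_Bj)

section
variable {P : Params}
variable {F : T4Family} {N : ℕ} [NeZero N] {K : ℕ}

/-- ★★★ **THE THREE CLASS LETTERS OF E″∕I AT THE RECORD — `𝐁 := Bj ν.M₁ Z k`, `reg' := closure (Node00.regMSCoPOfRecord F N ν K kc (maxDomT ν.M₁ Z))` — WITH THE GEOMETRY DISCHARGED**: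
`IsClosed reg'`, `closure reg ⊆ reg'`, and `hDreg'` (the `𝐁`-restricted averages are continuous ON `reg'`), now modulo NUMERICS ONLY: `0 < εreg`, the [B7] Prop. 2 window at
`α₀ := 2L²εreg` (`C₀(d)α₀ ≤ ⅓`, `2α₀ ≤ c′₂`), the floor `(d+14)·L ≤ M₁` (print's «big blocks», [15] (1) p.277 `R M₁`; [III] (2.13) `L^nξM₁`), the divisibility `M₁L^k ∣ N₀`, and
`k ≤ kc + 1` (constrained depth vs class depth; `kc = k` at the record). [cite: Balaban1985Variational, Thm 1 p.279, (1)–(2), (6)–(7) pp.277–279, (16)–(18) p.280; Balaban1988Convergent, (2.2) p.255, (2.11)–(2.13) pp.256–257; Balaban1985Averaging, Prop. 2 (52)–(54) p.26; Balaban1987RG1, (0.4) p.253] -/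
theorem classLetters_closure_regMSCoPOfRecord_lamBondsSeq (ν : Stage7Numerics) (hε : 0 < ν.εreg) {k : ℕ} (hk : k ≤ (F.P K).m + (F.P K).K)
    (hdiv : side (F.P K).L ν.M₁ k ∣ (F.P K).sitesPerDir 0) (hfloor : ((F.P K).d + 14) * (F.P K).L ≤ ν.M₁) (Z : Set (Site (F.P K) 0))
    (kc : ℕ) (hkc : k ≤ kc + 1)
    (hα3 : (143 * (((((F.P K).d + 4 : ℕ) : ℝ)) ^ 2 / 4) ^ 2) * (2 * ((F.P K).L : ℝ) ^ 2 * ν.εreg) ≤ 1 / 3)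
    (hα2 : 2 * (2 * ((F.P K).L : ℝ) ^ 2 * ν.εreg) ≤ 2 * deltaSU (Fin N) / ((((F.P K).d + 4) * (F.P K).L : ℕ) : ℝ) ^ 2) :
    IsClosed (closure (regMSCoPOfRecord F N ν K kc (maxDomT ν.M₁ Z))) ∧
      closure (regMSCoPOfRecord F N ν K kc (maxDomT ν.M₁ Z)) ⊆ closure (regMSCoPOfRecord F N ν K kc (maxDomT ν.M₁ Z)) ∧
      ContinuousOn (fun (U : GaugeField (F.P K) 0 (SU N)) (i : Fin (constrCardB (lamBondsSeq (maxDomT ν.M₁ Z) k) k)) =>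
        ((avgFamily (avOfRecord F N K) U ((constrEnumB (lamBondsSeq (maxDomT ν.M₁ Z) k) k).symm i).1 ((constrEnumB (lamBondsSeq (maxDomT ν.M₁ Z) k) k).symm i).2.1 : SU N) :
          Matrix (Fin N) (Fin N) ℂ))
        (closure (regMSCoPOfRecord F N ν K kc (maxDomT ν.M₁ Z))) :=
  classLetters_closure_regMSCoPOfRecord_of_coneBoxes ν hε hk kc (maxDomT ν.M₁ Z) (lamBondsSeq (maxDomT ν.M₁ Z) k) hα3 hα2 (fun j hj c hc => coneBoxLetter_Bj ν hk hdiv hfloor Z hkc j hj c (lamBondsSeq_subset_bondsOf_genSet _ _ j hc))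

end

end Summit.QuantumFields.YangMills.BalabanUVNodes.N12ClassLetterGeometryOfRecordB

end
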